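/-
HONEST FRAMING: systematic search; no irrationality claim unless certified.
-/
import Summits.KontsevichZagierPeriods.Zeta5Search.WedgeDictionaryThreeTerm
import HarnessLib

/-!
# The ghost ray of `explicitPQ`: one datum and the STAR/PENCIL families generate it (PROVED reduction)

D2 lane, gen-1 g16 (planner-pub-zeta5-gen-1-g16-0), 2026-08-21.  Companion of the memo
`pub-zeta5-gen-1/D2-INDUCTION-g16.md` (§3.12, "face templates"; this is the first template carried into Lean).

## What is proved

The dual points `G_n = (2n+1; n+1, 0, 0, 0, 0, n+1, 0)` — odd level `N = 2n+1`, the two NON-EDGE slots `1, 6` at the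
top value `(N+1)/2`, all other slots `0` — form the GHOST RAY of the region of `explicitPQ`; in `a`-coordinates
`G_n = (n, 0, 2n+1, 0, 2n+1, n, n, 2n+1)` (`ghostA n`), and `G_0 = (0,0,1,0,1,0,0,1)` is the "ghost datum" of the memo
(§1: the standard charts of the contiguity induction do not reach this class).  We prove
(`explicitPQAt_ghost_succ`, `explicitPQAt_ghost_ray`):

  assuming the four relation families recorded in `WedgeDictionaryThreeTerm` — `CellStar`, `DictStar`, `CellPencil`,
  `DictPencil` (conjectural tree statements, used as hypotheses) — `ExplicitPQAt G_n 2 → ExplicitPQAt G_{n+1} 2`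
  for every `n`, hence `ExplicitPQAt G_0 2 → ∀ n, ExplicitPQAt G_n 2`.

So on the ghost ray the whole of `explicitPQ` is ONE datum plus the relation families.  The mechanism is a chain of six
DEGENERATE three-term relations found by the elimination `code/gen1/g16/cert_sym.py` (`cert_ghost16_41.json`, the
"(1,6) two-top face template" of memo §4'): on a face with slots `1` and `6` both at the top value, the fan coefficient
`χ₁Π₁(P) = (P₀+1−P₁−P₆)(P₀+1−P₁−P₇)` VANISHES, so PENCIL(`G_n`, 1) and the STARs `(1,k)`, `k = 2,3,4,5,7`, lose their
third term and become two-term transfers: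
`G_n ↦ DS G_n = (N+2; n+2,1,1,1,1,n+2,1) ↦ −s₂ ↦ −s₃ ↦ −s₄ ↦ −s₅ ↦ −s₇ = G_{n+1}`,
with the surviving coefficients `(n+2)², 2(n+1), 2(n+1), 2(n+1)², (2n+3)², (n+1)(2n+3)` — all non-zero.
The generic tool is the middle-point form `at_of_threeTerm_mid` of the tree's 2-of-3 step (`at_of_threeTerm`):
a three-term relation whose THIRD coefficient is zero transfers `explicitPQ` from the first point to the second.

What this file is NOT: a proof of any STAR/PENCIL instance, of `ExplicitPQAt G_0 2`, or of anything about irrationality.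
-/

noncomputable section

open Finset

namespace Summit.KontsevichZagierPeriods.Zeta5Search.WedgeDictionary

open Literature.NumberTheory.Irrationality.BrownZudilin2022 (bOfA Converges convergenceForms cellularIntegral QOf)
open Literature.NumberTheory.Transcendental (zetaValue)

/-! ## 1. The middle-point form of the 2-of-3 step -/

/-- **2-of-3, middle point, degenerate third coefficient.** A three-term relation among the integrals whose
coefficients also kill the dictionary vectors, with `γ = 0` and `β ≠ 0`, transfers `explicitPQ` from `a₀` to `a₁`
(the third point only has to exist). [folklore] -/
theorem at_of_threeTerm_mid {α β γ : ℚ} {a₀ a₁ a₂ : Fin 8 → ℤ} {j₀ j₁ j₂ : ℕ} (hrel : ThreeTermRel α β γ a₀ a₁ a₂)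
    (hd : DictThreeTerm α β γ a₀ a₁ a₂ j₀ j₁ j₂) (h₀ : ExplicitPQAt a₀ j₀) (hβ : β ≠ 0) (hγ : γ = 0) :
    ExplicitPQAt a₁ j₁ := by
  obtain ⟨hq, hph, hp⟩ := hd
  have hq' : (α : ℝ) * (QOf a₀ : ℝ) + (β : ℝ) * (QOf a₁ : ℝ) + (γ : ℝ) * (QOf a₂ : ℝ) = 0 := by exact_mod_cast hq
  have hph' : (α : ℝ) * (dictPhat a₀ j₀ : ℝ) + (β : ℝ) * (dictPhat a₁ j₁ : ℝ) + (γ : ℝ) * (dictPhat a₂ j₂ : ℝ) = 0 := by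
    exact_mod_cast hph
  have hp' : (α : ℝ) * (dictP a₀ j₀ : ℝ) + (β : ℝ) * (dictP a₁ j₁ : ℝ) + (γ : ℝ) * (dictP a₂ j₂ : ℝ) = 0 := by
    exact_mod_cast hp
  have hβ' : (β : ℝ) ≠ 0 := by exact_mod_cast hβ
  have hγ' : (γ : ℝ) = 0 := by exact_mod_cast hγ
  unfold ThreeTermRel at hrel
  unfold ExplicitPQAt at h₀ ⊢
  rw [h₀] at hrel
  have key : (β : ℝ) * (cellularIntegral a₁ - ((QOf a₁ : ℝ) * (2 * zetaValue 5 + 4 * zetaValue 3 * zetaValue 2) -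
      4 * (dictPhat a₁ j₁ : ℝ) * zetaValue 2 - 2 * (dictP a₁ j₁ : ℝ))) = 0 := by
    linear_combination hrel - (2 * zetaValue 5 + 4 * zetaValue 3 * zetaValue 2) * hq' + 4 * zetaValue 2 * hph' +
      2 * hp' - (cellularIntegral a₂ - ((QOf a₂ : ℝ) * (2 * zetaValue 5 + 4 * zetaValue 3 * zetaValue 2) -
      4 * (dictPhat a₂ j₂ : ℝ) * zetaValue 2 - 2 * (dictP a₂ j₂ : ℝ))) * hγ'
  rcases mul_eq_zero.1 key with h | h
  · exact absurd h hβ'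
  · linarith

/-- **Degenerate PENCIL transfer (base ↦ apex).** If `χ_iΠ_i(DS b(a)) = 0` and the apex coefficient
`(c_i+1)(c₀+2−c_i) ≠ 0`, the PENCIL(`a`, `i`) relations transfer `explicitPQ` from `a` to `a + DS`. [folklore] -/
theorem at_pencil_apex (hc : CellPencil) (hd : DictPencil) {a : Fin 8 → ℤ} {i j₀ j₁ j₂ : ℕ} (hi : i ∈ Icc 1 7)
    (r₀ : RegionHyp a j₀) (r₁ : RegionHyp (a + dsUp) j₁) (r₂ : RegionHyp (a + dsUp + slotDown i) j₂)
    (h₀ : ExplicitPQAt a j₀) (hβ : pencilApex (bOfA a) i ≠ 0) (hγ : fanCoeff (bOfA (a + dsUp)) i = 0) :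
    ExplicitPQAt (a + dsUp) j₁ := by
  have hrel := hc a i j₀ j₁ j₂ hi r₀ r₁ r₂
  have hdic := hd a i j₀ j₁ j₂ hi r₀ r₁ r₂
  have hβ' : (pencilApex (bOfA a) i : ℚ) ≠ 0 := by exact_mod_cast hβ
  have hγ' : (fanCoeff (bOfA (a + dsUp)) i : ℚ) = 0 := by exact_mod_cast hγ
  exact at_of_threeTerm_mid hrel hdic h₀ hβ' hγ'

/-- **Degenerate STAR transfer (`a ↦ a − s_k`).** If `χ_iΠ_i(b(a)) = 0` and `χ_kΠ_k(b(a)) ≠ 0`, the STAR(`i`,`k`)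
relations at `a` transfer `explicitPQ` from `a` to `a − s_k`. [folklore] -/
theorem at_star_mid (hc : CellStar) (hd : DictStar) {a : Fin 8 → ℤ} {i k j₀ j₁ j₂ : ℕ} (hi : i ∈ Icc 1 7)
    (hk : k ∈ Icc 1 7) (hik : i ≠ k) (r₀ : RegionHyp a j₀) (r₁ : RegionHyp (a + slotDown k) j₁)
    (r₂ : RegionHyp (a + slotDown i) j₂) (h₀ : ExplicitPQAt a j₀) (hβ : fanCoeff (bOfA a) k ≠ 0)
    (hγ : fanCoeff (bOfA a) i = 0) : ExplicitPQAt (a + slotDown k) j₁ := by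
  have hrel := hc a i k j₀ j₁ j₂ hi hk hik r₀ r₁ r₂
  have hdic := hd a i k j₀ j₁ j₂ hi hk hik r₀ r₁ r₂
  have hβ' : (-fanCoeff (bOfA a) k : ℚ) ≠ 0 := by
    have : (fanCoeff (bOfA a) k : ℚ) ≠ 0 := by exact_mod_cast hβ
    exact neg_ne_zero.mpr this
  have hγ' : (fanCoeff (bOfA a) i : ℚ) = 0 := by exact_mod_cast hγ
  exact at_of_threeTerm_mid hrel hdic h₀ hβ' hγ'

/-! ## 2. The ghost ray and the chain of the template, in `a`-coordinates -/

/-- The ghost ray `G_n`: `a = (n, 0, 2n+1, 0, 2n+1, n, n, 2n+1)`, i.e. `b(a) = (2n+1; n+1, 0,0,0,0, n+1, 0)`. -/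
def ghostA (n : ℕ) : Fin 8 → ℤ := ![(n : ℤ), 0, 2 * (n : ℤ) + 1, 0, 2 * (n : ℤ) + 1, (n : ℤ), (n : ℤ), 2 * (n : ℤ) + 1]

/-- Chain point 0 (the PENCIL apex `DS G_n`): `b = (2n+3; n+2, 1,1,1,1, n+2, 1)`. -/
def ghostP0 (n : ℕ) : Fin 8 → ℤ := ![(n : ℤ), 1, 2 * (n : ℤ) + 1, 1, 2 * (n : ℤ) + 1, (n : ℤ), (n : ℤ), 2 * (n : ℤ) + 1]

/-- Chain point 1 (`= P0 − s₂`): `b = (2n+3; n+2, 0,1,1,1, n+2, 1)`. -/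
def ghostP1 (n : ℕ) : Fin 8 → ℤ :=
  ![(n : ℤ) + 1, 0, 2 * (n : ℤ) + 2, 1, 2 * (n : ℤ) + 1, (n : ℤ), (n : ℤ), 2 * (n : ℤ) + 1]

/-- Chain point 2 (`= P1 − s₃`): `b = (2n+3; n+2, 0,0,1,1, n+2, 1)`. -/
def ghostP2 (n : ℕ) : Fin 8 → ℤ :=
  ![(n : ℤ) + 1, 0, 2 * (n : ℤ) + 3, 0, 2 * (n : ℤ) + 2, (n : ℤ), (n : ℤ), 2 * (n : ℤ) + 2]

/-- Chain point 3 (`= P2 − s₄`): `b = (2n+3; n+2, 0,0,0,1, n+2, 1)`. -/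
def ghostP3 (n : ℕ) : Fin 8 → ℤ :=
  ![(n : ℤ) + 1, 0, 2 * (n : ℤ) + 3, 0, 2 * (n : ℤ) + 3, (n : ℤ), (n : ℤ), 2 * (n : ℤ) + 2]

/-- Chain point 4 (`= P3 − s₅`): `b = (2n+3; n+2, 0,0,0,0, n+2, 1)`; `P4 − s₇ = G_{n+1}`. -/
def ghostP4 (n : ℕ) : Fin 8 → ℤ :=
  ![(n : ℤ) + 1, 0, 2 * (n : ℤ) + 3, 0, 2 * (n : ℤ) + 3, (n : ℤ) + 1, (n : ℤ), 2 * (n : ℤ) + 3]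

/-- The dual coordinates of the ghost ray: `b(G_n) = (2n+1; n+1, 0, 0, 0, 0, n+1, 0)`. -/
theorem bOfA_ghostA (n : ℕ) :
    bOfA (ghostA n) 0 = 2 * (n : ℤ) + 1 ∧ bOfA (ghostA n) 1 = (n : ℤ) + 1 ∧ bOfA (ghostA n) 2 = 0 ∧
      bOfA (ghostA n) 3 = 0 ∧ bOfA (ghostA n) 4 = 0 ∧ bOfA (ghostA n) 5 = 0 ∧ bOfA (ghostA n) 6 = (n : ℤ) + 1 ∧
        bOfA (ghostA n) 7 = 0 := by
  refine ⟨?_, ?_, ?_, ?_, ?_, ?_, ?_, ?_⟩ <;> simp [bOfA, ghostA] <;> ring1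

/-- `G_0` is the ghost datum `a = (0,0,1,0,1,0,0,1)` of the memo. -/
theorem ghostA_zero : ghostA 0 = ![0, 0, 1, 0, 1, 0, 0, 1] := by
  ext i; fin_cases i <;> simp [ghostA]

/-- The six moves of the chain land on the named points. -/
theorem ghost_chain (n : ℕ) :
    ghostA n + dsUp = ghostP0 n ∧ ghostP0 n + slotDown 2 = ghostP1 n ∧ ghostP1 n + slotDown 3 = ghostP2 n ∧
      ghostP2 n + slotDown 4 = ghostP3 n ∧ ghostP3 n + slotDown 5 = ghostP4 n ∧
        ghostP4 n + slotDown 7 = ghostA (n + 1) := by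
  refine ⟨?_, ?_, ?_, ?_, ?_, ?_⟩ <;> ext i <;> fin_cases i <;>
    simp [ghostA, ghostP0, ghostP1, ghostP2, ghostP3, ghostP4, dsUp, slotDown, Nat.cast_add, Nat.cast_one] <;> ring1

/-! ## 3. The twelve points of the chain lie in the region (partner index `j = 2`) -/

section Region

/-- All chain points (and their slot-down partners) are region points with partner index `2`: for explicit
vectors with entries linear in `n` the seventeen forms, the box, `d ≥ 0` and the partner condition are `omega` facts. -/
theorem region_chain_all (n : ℕ) :
    RegionHyp (ghostA n) 2 ∧
      RegionHyp (ghostP0 n) 2 ∧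
      RegionHyp (ghostP0 n + slotDown 1) 2 ∧
      RegionHyp (ghostP1 n) 2 ∧
      RegionHyp (ghostP1 n + slotDown 1) 2 ∧
      RegionHyp (ghostP2 n) 2 ∧
      RegionHyp (ghostP2 n + slotDown 1) 2 ∧
      RegionHyp (ghostP3 n) 2 ∧
      RegionHyp (ghostP3 n + slotDown 1) 2 ∧
      RegionHyp (ghostP4 n) 2 ∧
      RegionHyp (ghostP4 n + slotDown 1) 2 := by
  refine ⟨?_, ?_, ?_, ?_, ?_, ?_, ?_, ?_, ?_, ?_, ?_⟩
  all_goals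
    refine ⟨by simp, ?_, ?_, ?_, ?_⟩
    · intro x hx
      simp [convergenceForms, ghostA, ghostP0, ghostP1, ghostP2, ghostP3, ghostP4, slotDown] at hx
      omega
    · intro i hi
      simp only [mem_Icc] at hi
      obtain ⟨h1, h7⟩ := hi
      interval_cases i <;> simp [bOfA, ghostA, ghostP0, ghostP1, ghostP2, ghostP3, ghostP4, slotDown] <;> omega
    · simp [dOf, Finset.sum_range_succ, bOfA, ghostA, ghostP0, ghostP1, ghostP2, ghostP3, ghostP4, slotDown]
      all_goals omega
    · simp [bOfA, ghostA, ghostP0, ghostP1, ghostP2, ghostP3, ghostP4, slotDown]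
      all_goals omega


/-- `G_n` is a region point. -/
theorem region_ghostA (n : ℕ) : RegionHyp (ghostA n) 2 := (region_chain_all n).1
/-- `P0` is a region point. -/
theorem region_ghostP0 (n : ℕ) : RegionHyp (ghostP0 n) 2 := (region_chain_all n).2.1
/-- `P0 − s₁` is a region point. -/
theorem region_ghostP0' (n : ℕ) : RegionHyp (ghostP0 n + slotDown 1) 2 := (region_chain_all n).2.2.1
/-- `P1` is a region point. -/
theorem region_ghostP1 (n : ℕ) : RegionHyp (ghostP1 n) 2 := (region_chain_all n).2.2.2.1
/-- `P1 − s₁` is a region point. -/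
theorem region_ghostP1' (n : ℕ) : RegionHyp (ghostP1 n + slotDown 1) 2 := (region_chain_all n).2.2.2.2.1
/-- `P2` is a region point. -/
theorem region_ghostP2 (n : ℕ) : RegionHyp (ghostP2 n) 2 := (region_chain_all n).2.2.2.2.2.1
/-- `P2 − s₁` is a region point. -/
theorem region_ghostP2' (n : ℕ) : RegionHyp (ghostP2 n + slotDown 1) 2 := (region_chain_all n).2.2.2.2.2.2.1
/-- `P3` is a region point. -/
theorem region_ghostP3 (n : ℕ) : RegionHyp (ghostP3 n) 2 := (region_chain_all n).2.2.2.2.2.2.2.1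
/-- `P3 − s₁` is a region point. -/
theorem region_ghostP3' (n : ℕ) : RegionHyp (ghostP3 n + slotDown 1) 2 := (region_chain_all n).2.2.2.2.2.2.2.2.1
/-- `P4` is a region point. -/
theorem region_ghostP4 (n : ℕ) : RegionHyp (ghostP4 n) 2 := (region_chain_all n).2.2.2.2.2.2.2.2.2.1
/-- `P4 − s₁` is a region point. -/
theorem region_ghostP4' (n : ℕ) : RegionHyp (ghostP4 n + slotDown 1) 2 := (region_chain_all n).2.2.2.2.2.2.2.2.2.2

end Region

/-! ## 4. The coefficients along the chain -/

/-- The vanishing third coefficients `χ₁Π₁ = 0` (slots 1, 6 at the top value) and the non-zero transfer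
coefficients `(n+2)², 2(n+1), 2(n+1), 2(n+1)², (2n+3)², (n+1)(2n+3)`. -/
theorem ghost_coeffs (n : ℕ) :
    pencilApex (bOfA (ghostA n)) 1 = ((n : ℤ) + 2) ^ 2 ∧ fanCoeff (bOfA (ghostP0 n)) 1 = 0 ∧
      fanCoeff (bOfA (ghostP0 n)) 2 = 2 * ((n : ℤ) + 1) ∧ fanCoeff (bOfA (ghostP1 n)) 1 = 0 ∧
        fanCoeff (bOfA (ghostP1 n)) 3 = 2 * ((n : ℤ) + 1) ∧ fanCoeff (bOfA (ghostP2 n)) 1 = 0 ∧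
          fanCoeff (bOfA (ghostP2 n)) 4 = 2 * ((n : ℤ) + 1) ^ 2 ∧ fanCoeff (bOfA (ghostP3 n)) 1 = 0 ∧
            fanCoeff (bOfA (ghostP3 n)) 5 = (2 * (n : ℤ) + 3) ^ 2 ∧ fanCoeff (bOfA (ghostP4 n)) 1 = 0 ∧
              fanCoeff (bOfA (ghostP4 n)) 7 = ((n : ℤ) + 1) * (2 * (n : ℤ) + 3) := by
  refine ⟨?_, ?_, ?_, ?_, ?_, ?_, ?_, ?_, ?_, ?_, ?_⟩ <;>
    simp [pencilApex, fanCoeff, chiOf, nonEdgePartners, bOfA, ghostA, ghostP0, ghostP1, ghostP2, ghostP3,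
      ghostP4, -mul_eq_zero] <;> ring1

/-! ## 5. The template: `G_n ↦ G_{n+1}`, and the whole ray from the datum -/

/-- **THE (1,6) TWO-TOP FACE TEMPLATE (PROVED).** Under the four relation families, `explicitPQ` at the ghost point
`G_n` implies `explicitPQ` at `G_{n+1}`: PENCIL(`G_n`,1) to the apex, then the degenerate STARs `(1,2), (1,3), (1,4),
(1,5), (1,7)`. [folklore] -/
theorem explicitPQAt_ghost_succ (hcS : CellStar) (hdS : DictStar) (hcP : CellPencil) (hdP : DictPencil) (n : ℕ)
    (h : ExplicitPQAt (ghostA n) 2) : ExplicitPQAt (ghostA (n + 1)) 2 := by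
  obtain ⟨e0, e1, e2, e3, e4, e5⟩ := ghost_chain n
  obtain ⟨cA, c01, c02, c11, c13, c21, c24, c31, c35, c41, c47⟩ := ghost_coeffs n
  have one7 : (1 : ℕ) ∈ Icc 1 7 := by simp
  -- step 0: PENCIL(G_n, 1): G_n ↦ P0 = G_n + DS
  have h0 : ExplicitPQAt (ghostP0 n) 2 := by
    have r₁ : RegionHyp (ghostA n + dsUp) 2 := by rw [e0]; exact region_ghostP0 n
    have r₂ : RegionHyp (ghostA n + dsUp + slotDown 1) 2 := by rw [e0]; exact region_ghostP0' n
    have hβ : pencilApex (bOfA (ghostA n)) 1 ≠ 0 := by rw [cA]; positivity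
    have hγ : fanCoeff (bOfA (ghostA n + dsUp)) 1 = 0 := by rw [e0]; exact c01
    have := at_pencil_apex hcP hdP one7 (region_ghostA n) r₁ r₂ h hβ hγ
    rw [e0] at this; exact this
  -- step 1: STAR(1,2) at P0: P0 ↦ P1
  have h1 : ExplicitPQAt (ghostP1 n) 2 := by
    have r₁ : RegionHyp (ghostP0 n + slotDown 2) 2 := by rw [e1]; exact region_ghostP1 n
    have hβ : fanCoeff (bOfA (ghostP0 n)) 2 ≠ 0 := by rw [c02]; positivity
    have := at_star_mid hcS hdS one7 (by simp) (by decide) (region_ghostP0 n) r₁ (region_ghostP0' n) h0 hβ c01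
    rw [e1] at this; exact this
  -- step 2: STAR(1,3) at P1: P1 ↦ P2
  have h2 : ExplicitPQAt (ghostP2 n) 2 := by
    have r₁ : RegionHyp (ghostP1 n + slotDown 3) 2 := by rw [e2]; exact region_ghostP2 n
    have hβ : fanCoeff (bOfA (ghostP1 n)) 3 ≠ 0 := by rw [c13]; positivity
    have := at_star_mid hcS hdS one7 (by simp) (by decide) (region_ghostP1 n) r₁ (region_ghostP1' n) h1 hβ c11
    rw [e2] at this; exact this
  -- step 3: STAR(1,4) at P2: P2 ↦ P3
  have h3 : ExplicitPQAt (ghostP3 n) 2 := by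
    have r₁ : RegionHyp (ghostP2 n + slotDown 4) 2 := by rw [e3]; exact region_ghostP3 n
    have hβ : fanCoeff (bOfA (ghostP2 n)) 4 ≠ 0 := by rw [c24]; positivity
    have := at_star_mid hcS hdS one7 (by simp) (by decide) (region_ghostP2 n) r₁ (region_ghostP2' n) h2 hβ c21
    rw [e3] at this; exact this
  -- step 4: STAR(1,5) at P3: P3 ↦ P4
  have h4 : ExplicitPQAt (ghostP4 n) 2 := by
    have r₁ : RegionHyp (ghostP3 n + slotDown 5) 2 := by rw [e4]; exact region_ghostP4 n
    have hβ : fanCoeff (bOfA (ghostP3 n)) 5 ≠ 0 := by rw [c35]; positivity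
    have := at_star_mid hcS hdS one7 (by simp) (by decide) (region_ghostP3 n) r₁ (region_ghostP3' n) h3 hβ c31
    rw [e4] at this; exact this
  -- step 5: STAR(1,7) at P4: P4 ↦ P4 − s₇ = G_{n+1}
  have r₁ : RegionHyp (ghostP4 n + slotDown 7) 2 := by rw [e5]; exact region_ghostA (n + 1)
  have hβ : fanCoeff (bOfA (ghostP4 n)) 7 ≠ 0 := by rw [c47]; positivity
  have := at_star_mid hcS hdS one7 (by simp) (by decide) (region_ghostP4 n) r₁ (region_ghostP4' n) h4 hβ c41
  rw [e5] at this; exact this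

/-- **THE GHOST RAY FROM ONE DATUM (PROVED).** Under the four relation families, `explicitPQ` at the ghost datum
`G_0 = (0,0,1,0,1,0,0,1)` gives `explicitPQ` along the whole ghost ray `G_n = (n,0,2n+1,0,2n+1,n,n,2n+1)`. [folklore] -/
theorem explicitPQAt_ghost_ray (hcS : CellStar) (hdS : DictStar) (hcP : CellPencil) (hdP : DictPencil)
    (h0 : ExplicitPQAt ![0, 0, 1, 0, 1, 0, 0, 1] 2) (n : ℕ) : ExplicitPQAt (ghostA n) 2 := by
  induction n with
  | zero => rw [ghostA_zero]; exact h0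
  | succ k ih => exact explicitPQAt_ghost_succ hcS hdS hcP hdP k ih

/-- Shape sanity: `explicitPQ` itself gives the ray directly (the points ARE region points with partner `2`), so the
template above is a genuine reduction of `explicitPQ` on the ray to the datum plus the families. [folklore] -/
theorem explicitPQAt_ghost_of_explicitPQ (h : explicitPQ) (n : ℕ) : ExplicitPQAt (ghostA n) 2 :=
  (explicitPQ_iff_at).1 h _ _ (region_ghostA n)

end Summit.KontsevichZagierPeriods.Zeta5Search.WedgeDictionary
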